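import Summits.CriticalPhenomena.PercolationContinuityZ3.Theorems.Transplant.DiamondLattice
import Literature.Probability.Percolation.CoveringMonotonicity
import Literature.Probability.Percolation.KestenTheoremProofs
import Literature.Probability.Percolation.CriticalContinuityProofs
import Mathlib.Tactic.FinCases
import Mathlib.Tactic.Ring
import HarnessLib

/-!
# The FLUORITE net (class C1b, row F — the first BINODAL quasi-transitive 3D net of the lane), I: the structure `CaF₂` in the bcc integer frame,
# its `[001]` skeleton, bonds, `p_c ≤ 1/2 < 1`, the cation translations as frames, quasi-transitivity with three base vertices

builds on p205010 (kernel theorem, internal audit signed; external expert review pending) — nothing in this file uses p205010.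
Status sentence (coordinator 2026-08-20T04:30Z): "θ(p_c) = 0 on ℤ^d, all d ≥ 2 — kernel-verified (Lean 4/Mathlib,
standard axioms); internal adversarial audit SIGNED 2026-08-20 04:29Z; external expert review pending."

Lane `prim-bschramm-*`, seat `prim-bschramm-p2` (gen 6).  The **fluorite net** (`CaF₂`; antifluorite, the `flu` net of reticular chemistry) in
the integer frame of the tree's bcc lattice: cations `Ca` on `2D₃ = {x even, x₀+x₁+x₂ ≡ 0 (mod 4)}` (an fcc lattice), anions `F` on ALL odd points
`2ℤ³ + (1,1,1) ∪ 2ℤ³ − (1,1,1)` (a simple cubic lattice of half the spacing), bonds `Ca–F` along `(±1,±1,±1)`: every cation has `8` anion neighbours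
(a cube), every anion `4` cation neighbours (a tetrahedron).  So `fluSite = diamondSite ∪ (−diamondSite)` and `fluGraph` is the induced subgraph of
`bccGraph` on it — NOT vertex-transitive (degrees `8` and `4`) but quasi-transitive with three orbits of the cation translations (`Ca`, and the two
anion classes `x₀+x₁+x₂ ≡ 3, 1 (mod 4)`), hence a genuine instance of Benjamini–Schramm's Conjecture 4 in its quasi-transitive form.
* `fluSkel = bccSkel ∘ toBcc` (the `[001]` projection onto the square net): from a cation all four skeleton steps (two bonds each), from an anion
  exactly one bond per skeleton step (`fluBondVec`, `flu_step`), so `fluSkel` maps neighbourhoods onto neighbourhoods and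
  **`p_c(flu) ≤ p_c(ℤ²) = 1/2 < 1`** (`criticalProb_flu_lt_one`, covering monotonicity + Kesten);
* FRAMES = translations by cation vectors (`fluShift`), three base vertices `0`, `(1,1,1)`, `(−1,−1,−1)` (`fluBase`, `fluShift_base`,
  `fluSkel_shift`); `flu_isQuasiTransitive`.
Parts II–III (`FluoriteConnected`, `FluoriteSkeletonConc`): connected cylinders about all three base vertices, the tetrahedral point group at each
base vertex (the twisted `D₄` lift of `DiamondSkeletonConc`), `PlanarSkeletonConc`, and `θ(p_c) = 0` on the fluorite net modulo the lane's node.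
[cite: ConwaySloane1999, Ch. 4 §7.3 (D₃⁺) and §6.4? — cf. §7.1 (D_n, D_n^*)] [cite: BenjaminiSchramm1996, Thm. 1 and Conj. 4] [cite: LyonsPeres2016, Thm. 6.47]
-/

noncomputable section

namespace Summit.CriticalPhenomena.PercolationContinuityZ3.Theorems.Transplant

open MeasureTheory Literature.Probability.Percolation Literature.Probability.LatticeModels SimpleGraph
open Literature.Barriers.CriticalPhenomena (IsQuasiTransitive IsGraphAmenable)

/-! ## §1 The fluorite structure inside the bcc frame -/

/-- **The vertex set of the fluorite net**: `x₀ ≡ x₁ ≡ x₂ (mod 2)` and (all odd, the anions) or (`x₀+x₁+x₂ ≡ 0 (mod 4)`, the cations `2D₃`).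
[cite: ConwaySloane1999, Ch. 4 §7.1 (D_n)] -/
def fluSite : Set (Site 3) :=
  {x | x 0 % 2 = x 2 % 2 ∧ x 1 % 2 = x 2 % 2 ∧ (x 2 % 2 = 1 ∨ (x 0 + x 1 + x 2) % 4 = 0)}

/-- Membership in `fluSite`. [folklore] -/
theorem mem_fluSite_iff (x : Site 3) :
    x ∈ fluSite ↔ x 0 % 2 = x 2 % 2 ∧ x 1 % 2 = x 2 % 2 ∧ (x 2 % 2 = 1 ∨ (x 0 + x 1 + x 2) % 4 = 0) := Iff.rfl

/-- The origin (a cation) is a fluorite site. [folklore] -/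
theorem zero_mem_fluSite : (0 : Site 3) ∈ fluSite := by simp [mem_fluSite_iff]

/-- `(1,1,1)` (an anion of the first class; the constant vector `1`) is a fluorite site. [folklore] -/
theorem b1_mem_fluSite : (1 : Site 3) ∈ fluSite := by
  rw [mem_fluSite_iff]; decide

/-- `(−1,−1,−1)` (an anion of the second class; the constant vector `−1`) is a fluorite site. [folklore] -/
theorem b2_mem_fluSite : (-1 : Site 3) ∈ fluSite := by
  rw [mem_fluSite_iff]; decide

/-- **Fluorite sites are bcc sites.** [folklore] -/
theorem fluSite_subset_bccSite : fluSite ⊆ bccSite := by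
  intro x hx
  obtain ⟨h0, h1, -⟩ := hx
  rw [mem_bccSite_iff]
  rcases Int.emod_two_eq_zero_or_one (x 2) with h2 | h2
  · refine Or.inl fun i => ?_
    rw [Int.even_iff]
    rcases (show i = 0 ∨ i = 1 ∨ i = 2 by fin_cases i <;> simp) with rfl | rfl | rfl <;> omega
  · refine Or.inr fun i => ?_
    rw [Int.odd_iff]
    rcases (show i = 0 ∨ i = 1 ∨ i = 2 by fin_cases i <;> simp) with rfl | rfl | rfl <;> omega

/-- **The diamond structure is the cation sublattice plus the first anion class of the fluorite net.** [cite: ConwaySloane1999, Ch. 4 §7.3] -/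
theorem diamondSite_subset_fluSite : diamondSite ⊆ fluSite := by
  intro x hx
  obtain ⟨h0, h1, h2⟩ := hx
  exact ⟨h0, h1, by omega⟩

/-- A fluorite site viewed as a bcc site. [folklore] -/
def toBccF (x : fluSite) : bccSite := ⟨x, fluSite_subset_bccSite x.2⟩

/-- Coordinates of `toBccF`. [folklore] -/
@[simp] theorem coe_toBccF (x : fluSite) : ((toBccF x : bccSite) : Site 3) = (x : Site 3) := rfl

/-- **The fluorite net as a graph**: fluorite sites joined by the bcc bonds `(±1,±1,±1)`; an induced subgraph of the bcc lattice.
[cite: ConwaySloane1999, Ch. 4 §7.1] -/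
def fluGraph : SimpleGraph fluSite := (distSqGraph 3 3).induce fluSite

/-- The origin (a cation). [folklore] -/
def fluOrigin : fluSite := ⟨0, zero_mem_fluSite⟩
/-- The anion base vertex `(1,1,1)`. [folklore] -/
def fluF₁ : fluSite := ⟨1, b1_mem_fluSite⟩
/-- The anion base vertex `(−1,−1,−1)`. [folklore] -/
def fluF₂ : fluSite := ⟨-1, b2_mem_fluSite⟩

/-- Adjacency in the fluorite net is bcc adjacency of the underlying sites. [folklore] -/
theorem fluGraph_adj (x y : fluSite) : fluGraph.Adj x y ↔ bccGraph.Adj (toBccF x) (toBccF y) := Iff.rfl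

/-- The fluorite net is locally finite. [folklore] -/
instance fluGraph_locallyFinite : fluGraph.LocallyFinite := distSqGraph_induce_locallyFinite 3 3 fluSite

/-! ## §2 The skeleton -/

/-- **The planar skeleton of the fluorite net**: the bcc rotated skeleton `((x₀+x₁)/2, (x₀−x₁)/2)`. [cite: KozmaNitzan2024, §4 p. 16] -/
def fluSkel (x : fluSite) : Site 2 := bccSkel (toBccF x)

/-- `fluSkel = bccSkel ∘ toBccF`. [folklore] -/
theorem fluSkel_eq (x : fluSite) : fluSkel x = bccSkel (toBccF x) := rfl

/-- `2 φ₀(x) = x₀ + x₁`. [folklore] -/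
theorem two_mul_fluSkel_zero (x : fluSite) : 2 * fluSkel x 0 = (x : Site 3) 0 + (x : Site 3) 1 := two_mul_bccSkel_zero (toBccF x)

/-- `2 φ₁(x) = x₀ − x₁`. [folklore] -/
theorem two_mul_fluSkel_one (x : fluSite) : 2 * fluSkel x 1 = (x : Site 3) 0 - (x : Site 3) 1 := two_mul_bccSkel_one (toBccF x)

/-- The skeleton of the origin. [folklore] -/
@[simp] theorem fluSkel_origin : fluSkel fluOrigin = 0 := bccSkel_origin

/-- The skeleton is `1`-Lipschitz along bonds. [folklore] -/
theorem fluSkel_lipschitz {x y : fluSite} (h : fluGraph.Adj x y) (i : Fin 2) : |fluSkel x i - fluSkel y i| ≤ 1 :=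
  bccSkel_lipschitz (x := toBccF x) (y := toBccF y) h i

/-! ## §3 The bonds: eight at a cation, four at an anion; at least one per skeleton direction -/

/-- The fibre component of the bond in skeleton direction `i` at `x`: `+1` at a cation (any choice works), at an anion the tetrahedral rule
of its class (`x₀+x₁+x₂ ≡ 3`: east/west down, north/south up; `≡ 1`: the reverse). [folklore] -/
def fluFibre (x : Site 3) (i : Fin 2) : ℤ :=
  if x 2 % 2 = 0 then 1 else (2 - (x 0 + x 1 + x 2) % 4) * (if i = 0 then 1 else -1)

/-- The fibre component is `±1`. [folklore] -/
theorem fluFibre_eq (x : Site 3) (hx : x ∈ fluSite) (i : Fin 2) : fluFibre x i = 1 ∨ fluFibre x i = -1 := by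
  obtain ⟨h0, h1, h2⟩ := hx
  unfold fluFibre
  split_ifs <;> omega

/-- **The bond of a fluorite site in skeleton direction `σ e_i`.** [folklore] -/
def fluBondVec (x : Site 3) (i : Fin 2) (σ : ℤ) : Site 3 := ![σ, if i = 0 then σ else -σ, fluFibre x i]

/-- Coordinates of `fluBondVec`. [folklore] -/
@[simp] theorem fluBondVec_zero (x : Site 3) (i : Fin 2) (σ : ℤ) : fluBondVec x i σ 0 = σ := rfl
/-- Coordinates of `fluBondVec`. [folklore] -/
@[simp] theorem fluBondVec_one (x : Site 3) (i : Fin 2) (σ : ℤ) : fluBondVec x i σ 1 = if i = 0 then σ else -σ := rfl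
/-- Coordinates of `fluBondVec`. [folklore] -/
@[simp] theorem fluBondVec_two (x : Site 3) (i : Fin 2) (σ : ℤ) : fluBondVec x i σ 2 = fluFibre x i := rfl

/-- The bond vectors have coordinates `±1`. [folklore] -/
theorem fluBondVec_unit (x : Site 3) (hx : x ∈ fluSite) (i : Fin 2) {σ : ℤ} (hσ : σ = 1 ∨ σ = -1) (j : Fin 3) :
    fluBondVec x i σ j = 1 ∨ fluBondVec x i σ j = -1 := by
  rcases (show j = 0 ∨ j = 1 ∨ j = 2 by fin_cases j <;> simp) with rfl | rfl | rfl
  · rw [fluBondVec_zero]; exact hσ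
  · rw [fluBondVec_one]
    rcases (show i = 0 ∨ i = 1 by fin_cases i <;> simp) with rfl | rfl
    · rw [if_pos rfl]; exact hσ
    · rw [if_neg (show (1 : Fin 2) ≠ 0 by decide)]; omega
  · rw [fluBondVec_two]; exact fluFibre_eq x hx i

/-- **The bond endpoint is again a fluorite site** (cation ↔ anion). [folklore] -/
theorem add_fluBondVec_mem (x : fluSite) (i : Fin 2) {σ : ℤ} (hσ : σ = 1 ∨ σ = -1) :
    (x : Site 3) + fluBondVec x i σ ∈ fluSite := by
  obtain ⟨h0, h1, h2⟩ := x.2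
  simp only [mem_fluSite_iff, Pi.add_apply, fluBondVec_zero, fluBondVec_one, fluBondVec_two, fluFibre]
  rcases (show i = 0 ∨ i = 1 by fin_cases i <;> simp) with rfl | rfl
  · rw [if_pos rfl, if_pos rfl]
    split_ifs with he <;> rcases hσ with rfl | rfl <;> omega
  · rw [if_neg (show (1 : Fin 2) ≠ 0 by decide), if_neg (show (1 : Fin 2) ≠ 0 by decide)]
    split_ifs with he <;> rcases hσ with rfl | rfl <;> omega

/-- The bond endpoint as a vertex. [folklore] -/
def fluBondEnd (x : fluSite) (i : Fin 2) {σ : ℤ} (hσ : σ = 1 ∨ σ = -1) : fluSite :=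
  ⟨(x : Site 3) + fluBondVec x i σ, add_fluBondVec_mem x i hσ⟩

/-- Coordinates of the bond endpoint. [folklore] -/
@[simp] theorem coe_fluBondEnd (x : fluSite) (i : Fin 2) {σ : ℤ} (hσ : σ = 1 ∨ σ = -1) :
    ((fluBondEnd x i hσ : fluSite) : Site 3) = (x : Site 3) + fluBondVec x i σ := rfl

/-- **The bond is an edge of the fluorite net.** [folklore] -/
theorem fluGraph_adj_bondEnd (x : fluSite) (i : Fin 2) {σ : ℤ} (hσ : σ = 1 ∨ σ = -1) : fluGraph.Adj x (fluBondEnd x i hσ) :=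
  BccConc.bccGraph_adj_addUnit (toBccF x) (fluBondVec_unit x x.2 i hσ)

/-- **The bond moves the skeleton by `σ e_i`.** [folklore] -/
theorem fluSkel_bondEnd (x : fluSite) (i : Fin 2) {σ : ℤ} (hσ : σ = 1 ∨ σ = -1) :
    fluSkel (fluBondEnd x i hσ) = fluSkel x + Pi.single i σ := by
  have hx0 := two_mul_fluSkel_zero x
  have hx1 := two_mul_fluSkel_one x
  have hy0 := two_mul_fluSkel_zero (fluBondEnd x i hσ)
  have hy1 := two_mul_fluSkel_one (fluBondEnd x i hσ)
  have ey0 : ((fluBondEnd x i hσ : fluSite) : Site 3) 0 = (x : Site 3) 0 + σ := rfl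
  have ey1 : ((fluBondEnd x i hσ : fluSite) : Site 3) 1 = (x : Site 3) 1 + (if i = 0 then σ else -σ) := rfl
  rw [ey0] at hy0 hy1
  rw [ey1] at hy0 hy1
  ext j
  rcases (show i = 0 ∨ i = 1 by fin_cases i <;> simp) with rfl | rfl <;>
    rcases (show j = 0 ∨ j = 1 by fin_cases j <;> simp) with rfl | rfl
  · rw [if_pos rfl] at hy0 hy1
    rw [Pi.add_apply, Pi.single_eq_same]; omega
  · rw [if_pos rfl] at hy0 hy1
    rw [Pi.add_apply, Pi.single_eq_of_ne (by decide)]; omega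
  · rw [if_neg (by decide)] at hy0 hy1
    rw [Pi.add_apply, Pi.single_eq_of_ne (by decide)]; omega
  · rw [if_neg (by decide)] at hy0 hy1
    rw [Pi.add_apply, Pi.single_eq_same]; omega

/-- **(ι) OUTWARD STEPS** at every fluorite site. [cite: KozmaNitzan2024, §4 p. 16] -/
theorem flu_step (v : fluSite) (i : Fin 2) (σ : ℤˣ) :
    ∃ v' : fluSite, fluGraph.Adj v v' ∧ fluSkel v' = fluSkel v + Pi.single i (σ : ℤ) := by
  have hσ : (σ : ℤ) = 1 ∨ (σ : ℤ) = -1 := by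
    rcases Int.units_eq_one_or σ with rfl | rfl <;> simp
  exact ⟨fluBondEnd v i hσ, fluGraph_adj_bondEnd v i hσ, fluSkel_bondEnd v i hσ⟩

/-- **The skeleton is a weak covering map onto the square lattice.** [cite: BenjaminiSchramm1996, Thm. 1] [cite: LyonsPeres2016, Thm. 6.47] -/
theorem fluSkel_surjOn (x : fluSite) :
    Set.SurjOn fluSkel (fluGraph.neighborSet x) ((zdGraph 2).neighborSet (fluSkel x)) := by
  intro w hw
  rw [SimpleGraph.mem_neighborSet, zdGraph_adj_iff] at hw
  obtain ⟨i, h | h⟩ := hw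
  · obtain ⟨v', hadj, hv'⟩ := flu_step x i 1
    exact ⟨v', hadj, by rw [hv', h, Units.val_one]⟩
  · obtain ⟨v', hadj, hv'⟩ := flu_step x i (-1)
    refine ⟨v', hadj, ?_⟩
    rw [hv', Units.val_neg, Units.val_one]
    have : w = fluSkel x - Pi.single i 1 := eq_sub_of_add_eq h.symm
    rw [this, sub_eq_add_neg, ← Pi.single_neg]

/-- **`p_c(flu) ≤ p_c(ℤ²)`** (covering monotonicity). [cite: BenjaminiSchramm1996, Thm. 1] [cite: LyonsPeres2016, Thm. 6.47] -/
theorem criticalProb_flu_le_zd2 : criticalProb fluGraph fluOrigin ≤ criticalProb (zdGraph 2) (0 : Site 2) := by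
  refine criticalProb_le_of_theta_pos_imp fun p hp => ?_
  rw [← fluSkel_origin] at hp
  exact hp.trans_le (LyonsPeres647.theta_le_of_surjOn_neighborSet fluGraph (zdGraph 2) fluSkel fluSkel_surjOn fluOrigin p)

/-- **`p_c(flu) < 1`** (`≤ 1/2` by Kesten). [cite: BenjaminiSchramm1996, Thm. 1 and Conj. 4] -/
theorem criticalProb_flu_lt_one : criticalProb fluGraph fluOrigin < 1 :=
  criticalProb_flu_le_zd2.trans_lt (criticalProb_zd_lt_one le_rfl)

/-! ## §4 Frames: the cation translations; three base vertices; quasi-transitivity -/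

/-- The cation sublattice `2D₃` (even coordinates, sum `≡ 0 (mod 4)`) — the translation vectors. [cite: ConwaySloane1999, Ch. 4 §7.1] -/
def caVec : Set (Site 3) := {a | a 0 % 2 = 0 ∧ a 1 % 2 = 0 ∧ a 2 % 2 = 0 ∧ (a 0 + a 1 + a 2) % 4 = 0}

/-- Membership in `caVec`. [folklore] -/
theorem mem_caVec_iff (a : Site 3) : a ∈ caVec ↔ a 0 % 2 = 0 ∧ a 1 % 2 = 0 ∧ a 2 % 2 = 0 ∧ (a 0 + a 1 + a 2) % 4 = 0 := Iff.rfl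

/-- Cation vectors are fluorite (indeed bcc) sites. [folklore] -/
theorem caVec_subset_fluSite : caVec ⊆ fluSite := fun a ha => by
  obtain ⟨h0, h1, h2, h3⟩ := ha; exact ⟨by omega, by omega, Or.inr h3⟩

/-- Translating a fluorite site by a cation vector gives a fluorite site. [folklore] -/
theorem add_caVec_mem {w a : Site 3} (hw : w ∈ fluSite) (ha : a ∈ caVec) : w + a ∈ fluSite := by
  obtain ⟨h0, h1, h2⟩ := hw
  obtain ⟨g0, g1, g2, g3⟩ := ha
  simp only [mem_fluSite_iff, Pi.add_apply]
  refine ⟨by omega, by omega, ?_⟩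
  omega

/-- … and so does translating backwards. [folklore] -/
theorem sub_caVec_mem {w a : Site 3} (hw : w ∈ fluSite) (ha : a ∈ caVec) : w - a ∈ fluSite := by
  obtain ⟨h0, h1, h2⟩ := hw
  obtain ⟨g0, g1, g2, g3⟩ := ha
  simp only [mem_fluSite_iff, Pi.sub_apply]
  refine ⟨by omega, by omega, ?_⟩
  omega

/-- **Translation by a cation vector is an automorphism of the fluorite net.** [cite: ConwaySloane1999, Ch. 4 §7.1] -/
def fluShift (a : Site 3) (ha : a ∈ caVec) : fluGraph ≃g fluGraph where
  toEquiv :=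
    { toFun := fun w => ⟨(w : Site 3) + a, add_caVec_mem w.2 ha⟩
      invFun := fun w => ⟨(w : Site 3) - a, sub_caVec_mem w.2 ha⟩
      left_inv := fun w => Subtype.ext (add_sub_cancel_right _ _)
      right_inv := fun w => Subtype.ext (sub_add_cancel _ _) }
  map_rel_iff' := by
    intro x y
    change (distSqGraph 3 3).Adj ((x : Site 3) + a) ((y : Site 3) + a) ↔ (distSqGraph 3 3).Adj x y
    simp only [distSqGraph_adj, Pi.add_apply, add_sub_add_right_eq_sub, ne_eq, add_left_inj]

/-- Coordinates of the translation. [folklore] -/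
@[simp] theorem coe_fluShift (a : Site 3) (ha : a ∈ caVec) (w : fluSite) : ((fluShift a ha w : fluSite) : Site 3) = (w : Site 3) + a := rfl

/-- **Translations translate the skeleton** (additivity of the bcc skeleton). [folklore] -/
theorem fluSkel_shift (a : Site 3) (ha : a ∈ caVec) (w : fluSite) :
    fluSkel (fluShift a ha w) = fluSkel w + bccSkel ⟨a, fluSite_subset_bccSite (caVec_subset_fluSite ha)⟩ :=
  bccSkel_add ⟨(w : Site 3), fluSite_subset_bccSite w.2⟩ ⟨a, fluSite_subset_bccSite (caVec_subset_fluSite ha)⟩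

/-- The base vertex of the class of `v`: `0` for cations, `(1,1,1)` resp. `(−1,−1,−1)` for the two anion classes. [folklore] -/
def fluBase (v : Site 3) : Site 3 :=
  if v 2 % 2 = 0 then 0 else if (v 0 + v 1 + v 2) % 4 = 3 then 1 else -1

/-- The base vertex is one of the three. [folklore] -/
theorem fluBase_cases (v : Site 3) : fluBase v = 0 ∨ fluBase v = 1 ∨ fluBase v = -1 := by
  unfold fluBase; split_ifs <;> simp

/-- The base vertex is a fluorite site. [folklore] -/
theorem fluBase_mem (v : Site 3) : fluBase v ∈ fluSite := by
  rcases fluBase_cases v with h | h | h <;> rw [h]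
  · exact zero_mem_fluSite
  · exact b1_mem_fluSite
  · exact b2_mem_fluSite

/-- **`v − base(v)` is a cation vector.** [folklore] -/
theorem sub_fluBase_mem_caVec {v : Site 3} (hv : v ∈ fluSite) : v - fluBase v ∈ caVec := by
  obtain ⟨h0, h1, h2⟩ := hv
  unfold fluBase
  simp only [mem_caVec_iff, Pi.sub_apply]
  split_ifs with he h3
  · simp only [Pi.zero_apply, sub_zero]; omega
  · simp only [Pi.one_apply]; omega
  · simp only [Pi.neg_apply, Pi.one_apply]; omega

/-- The three base vertices. [folklore] -/
def fluTypes : Finset fluSite := {fluOrigin, fluF₁, fluF₂}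

/-- The base vertex of `v`, as a member of `fluTypes`. [folklore] -/
theorem fluBase_mem_fluTypes (v : Site 3) : (⟨fluBase v, fluBase_mem v⟩ : fluSite) ∈ fluTypes := by
  rcases fluBase_cases v with h | h | h
  · have : (⟨fluBase v, fluBase_mem v⟩ : fluSite) = fluOrigin := Subtype.ext h
    rw [this]; simp [fluTypes]
  · have : (⟨fluBase v, fluBase_mem v⟩ : fluSite) = fluF₁ := Subtype.ext h
    rw [this]; simp [fluTypes]
  · have : (⟨fluBase v, fluBase_mem v⟩ : fluSite) = fluF₂ := Subtype.ext h
    rw [this]; simp [fluTypes]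

/-- **FRAMES**: every vertex is the translate of its base vertex by a cation vector, and the translation translates the skeleton by
`φ v − φ base(v)`. [cite: KozmaNitzan2024, §4 p. 15] -/
theorem flu_frame (v : fluSite) :
    ∃ t ∈ fluTypes, ∃ α : fluGraph ≃g fluGraph, α t = v ∧ ∀ w, fluSkel (α w) = fluSkel w + (fluSkel v - fluSkel t) := by
  refine ⟨⟨fluBase v, fluBase_mem v⟩, fluBase_mem_fluTypes v, fluShift _ (sub_fluBase_mem_caVec v.2), ?_, fun w => ?_⟩
  · apply Subtype.ext
    rw [coe_fluShift]
    exact add_sub_cancel _ _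
  · rw [fluSkel_shift]
    congr 1
    -- `φ(v − b) = φ v − φ b` by additivity: `φ v = φ((v − b) + b) = φ(v − b) + φ b`
    have hadd := bccSkel_add ⟨(v : Site 3) - fluBase v, fluSite_subset_bccSite (caVec_subset_fluSite (sub_fluBase_mem_caVec v.2))⟩
      ⟨fluBase v, fluSite_subset_bccSite (fluBase_mem v)⟩
    have hv : (⟨(v : Site 3) - fluBase v, fluSite_subset_bccSite (caVec_subset_fluSite (sub_fluBase_mem_caVec v.2))⟩ +
        ⟨fluBase v, fluSite_subset_bccSite (fluBase_mem v)⟩ : bccSubgroup) = ⟨(v : Site 3), fluSite_subset_bccSite v.2⟩ :=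
      Subtype.ext (sub_add_cancel _ _)
    rw [hv] at hadd
    exact eq_sub_of_add_eq hadd.symm

/-- **The fluorite net is quasi-transitive** (three orbits of the cation translations). [cite: BenjaminiSchramm1996, §2] -/
theorem flu_isQuasiTransitive : IsQuasiTransitive fluGraph := by
  refine ⟨fluTypes, fun v => ?_⟩
  obtain ⟨t, ht, α, hαt, -⟩ := flu_frame v
  refine ⟨α.symm, ?_⟩
  rw [show α.symm v = t from (RelIso.symm_apply_eq α).2 hαt.symm]
  exact ht

end Summit.CriticalPhenomena.PercolationContinuityZ3.Theorems.Transplant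

end
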